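import Literature.Computability.QuantumComplexity.UniversalExecutorInput
import Literature.Computability.QuantumComplexity.SubroutineUniform
import Literature.Computability.QuantumComplexity.PadDecider
import HarnessLib

/-!
# Removing a `BQP` oracle from polynomial-time generated circuits (BBBV 1997, Cor. 4.15, generated form)

Topic `Literature/Computability/QuantumComplexity`; the oracle companion of
`GeneratedCircuitsSolvable.isQSolvable_of_generated_circuits`. A bounded-error quantum search
algorithm is often printed as a classical polynomial-time program that, from the input `x`, writes a
quantum circuit `C x` calling a *subroutine* for a language `A` already known to be in `BQP`
(Nielsen–Chuang 2010, §4.5; Bennett–Bernstein–Brassard–Vazirani 1997, §4: "if `BQP` machines are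
used as subroutines … `BQP^BQP = BQP`", Cor. 4.15). This file proves that form of the principle in
the tree's model:

* `OracleImpl.substCirc B C` — ONE circuit `C` on `N` wires with its oracle gates replaced by the
  blocks of `B` (`OracleImpl.substGates`, fresh wires from `N` on), and
  **`OracleImpl.probEvent_substCirc_ge`**: for every event `T` of the first `N` wires,
  `P_C^A[T] − numOracle · ε ≤ P_{substCirc}[T ∘ restrict]` when `B` implements `A` up to `ε`
  (BBBV Thm. 3.1 with the tree's `implOn_substGates`; the one-circuit form of
  `OracleImpl.kernelProb_substFamily_ge`);
* `GenSubst.descF` — the description `⟨1^{width}, raw gates⟩` of the substituted circuit as a string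
  function of `x`, computed by the counted loop of `SubroutineUniform.lean` (`SubstUniform.body`,
  `SubstUniform.loopModel_run`) started on the gate codes of `C x`; **`GenSubst.descF_mem_FP`**,
  **`GenSubst.descF_apply`**;
* **`exists_generated_oracleFree`**: if `A ∈ BQP`, `x ↦ (1^{k x}, rawGates (C x))` is computed on
  codes in polynomial time, every `C x` is a Clifford+`T` circuit on `k x ≥ 1` wires whose oracle gates
  query `A`, `post ∈ FP`, and `C x` run WITH the oracle `A` on `|0…0⟩` and measured yields with
  probability `≥ 2/3 + δ` (`δ > 0`) a content `f` with `post ⟨x, f⟩ ∈ Rel x`, then there are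
  ORACLE-FREE circuits `C' x` on `k' x ≥ 1` wires, again generated in polynomial time, and `post' ∈ FP`
  with the same guarantee at probability `≥ 2/3`: tidy blocks of precision `q(|x|) = c₀ (p(|x|) + 1)`,
  `c₀ ≥ 2/δ`, `p` the length polynomial of the description (`exists_uniform_deciderFamily`,
  `DeciderFamily.tidy_implements`, `DeciderFamily.tidy_isUniform`), substituted gate by gate
  (`substCirc`; cost `≤ δ`), the post-processor first truncating the register to its first `k x`
  wires. With `GeneratedCircuitsSolvable.isQSolvable_of_generated_circuits` this gives
  `IsQSolvable Rel` for extension-closed `Rel` (`GeneratedOracleCircuits.lean`).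

Everything is proved; no named fact is introduced.

## References

* C. H. Bennett, E. Bernstein, G. Brassard, U. Vazirani, *Strengths and weaknesses of quantum
  computing*, SIAM J. Comput. 26 (1997) 1510–1523, §4, Thm. 3.1, Thm. 4.13, Thm. 4.14, Cor. 4.15
  (`BQP^BQP = BQP`) [BennettBernsteinBrassardVazirani1997].
* M. A. Nielsen, I. L. Chuang, *Quantum Computation and Quantum Information*, CUP 2010, §4.5
  (uniform families: a classical computer outputs a description of the circuit) [NielsenChuang2010].
* S. Arora, B. Barak, *Computational Complexity: A Modern Approach*, CUP 2009, §1.3, §6.2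
  Remark 6.7 [AroraBarak2009].
-/

noncomputable section

namespace Literature.Computability.QuantumComplexity

open _root_.Computability Polynomial Complexity Complexity.Brick Plumb Cryptography Matrix

/-! ### Substituting blocks in one circuit -/

namespace OracleImpl

variable {N : ℕ}

/-- **The substituted circuit** of one circuit `C` on `N` wires: the oracle gates replaced by the
blocks of `B`, the fresh ancilla wires numbered from `N` on (`N + extra` wires in all).
[cite: BennettBernsteinBrassardVazirani1997, Cor. 4.15 (replace each oracle call by a tidy machine)] -/
def substCirc (B : OracleImpl cliffordT) (C : QCircuit cliffordT N) : QCircuit cliffordT (N + B.extra C.gates) :=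
  ⟨substGates B (Nat.le_add_right N (B.extra C.gates)) N C.gates⟩

/-- The substituted circuit is oracle-free when the blocks are. [folklore] -/
theorem substCirc_isOracleFree (B : OracleImpl cliffordT) (hB : ∀ k, (B.circ k).IsOracleFree)
    (C : QCircuit cliffordT N) : (substCirc B C).IsOracleFree :=
  substGates_isOracleFree B hB _ _ _

/-- **The output distribution of the substituted circuit**: for every event `T` read on the first
`N` wires, the substituted (oracle-free) circuit run on `|0…0⟩` lands in `T` with probability at
least `P_C^A[T] − numOracle · ε`, `P_C^A` the Born law of `C` run WITH the oracle `A` on `|0…0⟩`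
(`implOn_substGates`: the two final states are `numOracle · ε` close; BBBV Thm. 3.1: close states
have close statistics; in the ideal run the fresh wires stay `0`).
[cite: BennettBernsteinBrassardVazirani1997, Cor. 4.15 with Thm. 3.1] -/
theorem probEvent_substCirc_ge (B : OracleImpl cliffordT) {A : Language Bool} {ε : ℝ}
    (hB : B.Implements A ε) (hε : 0 ≤ ε) (C : QCircuit cliffordT N) (T : QReg N → Prop) :
    C.probEvent A (basisState fun _ => false) {f | T f} - numOracle C.gates * ε ≤
      (substCirc B C).probEvent 0 (basisState fun _ => false)
        {f' | T (f' ∘ Fin.castLEEmb (Nat.le_add_right N (B.extra C.gates)))} := by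
  classical
  have hNW : N ≤ N + B.extra C.gates := Nat.le_add_right N _
  set V := C.toMatrix A with hV
  set w : QReg (N + B.extra C.gates) := fun _ => false with hw
  have hwN : ∀ i : Fin (N + B.extra C.gates), N ≤ (i : ℕ) → w i = false := fun _ _ => rfl
  -- the substituted run as a Born sum
  have hreal : (substCirc B C).probEvent 0 (basisState w) {f' | T (f' ∘ Fin.castLEEmb hNW)} =
      ∑ z ∈ Finset.univ.filter (fun z : QReg (N + B.extra C.gates) => T (z ∘ Fin.castLEEmb hNW)),
        ‖((substCirc B C).toMatrix 0 *ᵥ basisState w) z‖ ^ 2 := by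
    rw [QCircuit.probEvent, Finset.sum_filter, Finset.sum_filter]
    refine Finset.sum_congr rfl fun z _ => ?_
    simp only [Set.mem_setOf_eq, QCircuit.runOn]
  -- the ideal run: `C` with the oracle on the first `N` wires, fresh wires idle
  have hideal : (∑ z ∈ Finset.univ.filter (fun z : QReg (N + B.extra C.gates) => T (z ∘ Fin.castLEEmb hNW)),
        ‖(placeGate (Fin.castLEEmb hNW) V *ᵥ basisState w) z‖ ^ 2) =
      C.probEvent A (basisState fun _ => false) {f | T f} := by
    rw [Finset.sum_filter, sum_normSq_placeGate_castLE hNW V w T, QCircuit.probEvent, Finset.sum_filter]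
    refine Finset.sum_congr rfl fun u _ => ?_
    simp only [Set.mem_setOf_eq, QCircuit.runOn, mulVec_basisState]
    rfl
  have himpl : ImplOn (CleanAbove N (N + B.extra C.gates)) ((substCirc B C).toMatrix 0)
      (placeGate (Fin.castLEEmb hNW) V) (numOracle C.gates * ε) :=
    implOn_substGates cliffordT_isUnitary_holds B hB hε hNW 0 C.gates N le_rfl le_rfl
  have hstat := abs_sum_normSq_sub_le_of_implOn
    (QCircuit.toMatrix_mem_unitaryGroup_holds cliffordT_isUnitary_holds 0 _)
    (placeGate_mem_unitaryGroup_holds _ (QCircuit.toMatrix_mem_unitaryGroup_holds cliffordT_isUnitary_holds A _))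
    himpl (ψ := basisState w) (suppIn_basisState fun i hi => hwN i hi) (normSq_basisState w)
    (Finset.univ.filter fun z : QReg (N + B.extra C.gates) => T (z ∘ Fin.castLEEmb hNW))
  rw [hideal] at hstat
  rw [hreal]
  have := (abs_sub_le_iff.1 hstat).2
  linarith

/-- The raw-list code of the substituted circuit. [folklore] -/
theorem encode_substCirc (B : OracleImpl cliffordT) (C : QCircuit cliffordT N) :
    (substCirc B C).encode =
      encList ((substGates B (Nat.le_add_right N (B.extra C.gates)) N C.gates).map QGate.encode) :=
  QCircuit.encode_eq_encList _

end OracleImpl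

/-! ### The description of the substituted generated circuit -/

namespace GenSubst

variable (S : TidyFamily cliffordT) (q Py : Polynomial ℕ) (Dn : List Bool → List Bool)

/-- The context `⟨yardstick, 1^{q |z|}⟩` from `z`. [folklore] -/
def ctxF : List Bool → List Bool := fanoutFn (polyFn Py) (polyFn q)

/-- `bin N`, the width of `C z`, read off the description `Dn z = ⟨1^N, codes⟩`. [folklore] -/
def NbinF : List Bool → List Bool := lenBinF ∘ fstF ∘ Dn

/-- The gate codes of `C z`. [folklore] -/
def codesF : List Bool → List Bool := sndF ∘ Dn

/-- The initial loop record `⟨ctx, ⟨bin |ctx|, ⟨codes, ⟨bin N, []⟩⟩⟩⟩`. [folklore] -/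
def initF : List Bool → List Bool :=
  fanoutFn (ctxF q Py) (fanoutFn (lenBinF ∘ ctxF q Py) (fanoutFn (codesF Dn) (fanoutFn (NbinF Dn) (fun _ => []))))

/-- The final record, after `|ctx|` rounds of `SubstUniform.body S`. [cite: AroraBarak2009, §1.3 (bounded loops)] -/
def resF : List Bool → List Bool := SubstUniform.loopF S ∘ initF q Py Dn

/-- The number of fresh wires in unary (final offset minus `N`, capped by the yardstick). [folklore] -/
def extraUF : List Bool → List Bool :=
  binToUnaryFn ∘ fanoutFn (polyFn Py) (subFn ∘ fanoutFn (nthF 3 ∘ resF S q Py Dn) (NbinF Dn))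

/-- **The description `⟨1^{N + extra}, codes⟩` of the substituted generated circuit**, as a string
function of the input. [cite: AroraBarak2009, §6.2 Remark 6.7] -/
def descF : List Bool → List Bool :=
  fanoutFn (fun z => fstF (Dn z) ++ extraUF S q Py Dn z) (sndPow 3 ∘ resF S q Py Dn)

variable {S q Py Dn}

/-- **`descF ∈ FP`** for `Dn ∈ FP` and a uniform tidy family. [cite: AroraBarak2009, §1.3 and §6.2 Remark 6.7] -/
theorem descF_mem_FP (hDn : Dn ∈ FP) (hS : S.IsUniform) : descF S q Py Dn ∈ FP := by
  obtain ⟨pS, hpS⟩ := exists_poly_length_le_of_mem_FP (TidyFamily.ddF_mem_FP_of_isUniform hS)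
  have hctx : ctxF q Py ∈ FP := fanoutFn_mem_FP (polyFn_mem_FP _) (polyFn_mem_FP _)
  have hN : NbinF Dn ∈ FP := comp_mem_FP lenBinF_mem_FP (comp_mem_FP fstF_mem_FP hDn)
  have hinit : initF q Py Dn ∈ FP := fanoutFn_mem_FP hctx (fanoutFn_mem_FP (comp_mem_FP lenBinF_mem_FP hctx)
    (fanoutFn_mem_FP (comp_mem_FP sndF_mem_FP hDn) (fanoutFn_mem_FP hN (const_mem_FP _))))
  have hloop : SubstUniform.loopF S ∈ FP :=
    loopFn_mem_FP_of_poly (SubstUniform.body_mem_FP hS) (SubstUniform.bodyPoly pS) (SubstUniform.length_body_le pS hpS) X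
  have hres : resF S q Py Dn ∈ FP := comp_mem_FP hloop hinit
  have hex : extraUF S q Py Dn ∈ FP := comp_mem_FP binToUnaryFn_mem_FP (fanoutFn_mem_FP (polyFn_mem_FP _)
    (comp_mem_FP subFn_mem_FP (fanoutFn_mem_FP (comp_mem_FP (nthF_mem_FP 3) hres) hN)))
  have hanc : (fun z => fstF (Dn z) ++ extraUF S q Py Dn z) ∈ FP :=
    append_mem_FP (comp_mem_FP fstF_mem_FP hDn) hex
  exact fanoutFn_mem_FP hanc (comp_mem_FP (sndPow_mem_FP 3) hres)

/-- **`descF` prints the description of the substituted circuit** when, at `z`, `Dn z = ⟨1^N, codes of C⟩`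
and the yardstick `1^{Py |z|}` dominates the width of the substituted circuit, the size of `C` and
the bound `M` of the blocks met. [cite: BennettBernsteinBrassardVazirani1997, Cor. 4.15] -/
theorem descF_apply {z : List Bool} {N : ℕ} (C : QCircuit cliffordT N)
    (hDz : Dn z = boolPair (CodeFP.unE N) C.encode) (M : ℕ)
    (hM : ∀ k (e : Fin (k + 1) ↪ Fin N), QGate.oracle k e ∈ C.gates →
      (S.circ k (q.eval z.length)).size ≤ M ∧ k + 1 + S.anc k (q.eval z.length) ≤ M)
    (hPy : N + (S.fix (q.eval z.length)).extra C.gates ≤ Py.eval z.length ∧ M ≤ Py.eval z.length ∧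
      C.size ≤ Py.eval z.length) :
    descF S q Py Dn z = UExec.tcE (N + (S.fix (q.eval z.length)).extra C.gates,
      (OracleImpl.substCirc (S.fix (q.eval z.length)) C).rawGates) := by
  obtain ⟨hPy1, hPy2, hPy3⟩ := hPy
  set r := q.eval z.length with hr
  have hNW : N ≤ N + (S.fix r).extra C.gates := Nat.le_add_right N _
  have hyl : (ones (Py.eval z.length)).length = Py.eval z.length := by simp [ones]
  have hNbin : NbinF Dn z = encodeNat N := by
    rw [NbinF, Function.comp_apply, Function.comp_apply, hDz, fstF_boolPair, lenBinF_apply, CodeFP.length_unE]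
  have hcodes : codesF Dn z = encList (C.gates.map QGate.encode) := by
    rw [codesF, Function.comp_apply, hDz, sndF_boolPair, QCircuit.encode_eq_encList]
  have hctx : ctxF q Py z = boolPair (ones (Py.eval z.length)) (ones r) := by
    rw [ctxF, fanoutFn_apply, polyFn_apply, polyFn_apply]
  have hinit : initF q Py Dn z = boolPair (boolPair (ones (Py.eval z.length)) (ones r))
      (boolPair (encodeNat (boolPair (ones (Py.eval z.length)) (ones r)).length)
        (SubstUniform.stateStr C.gates N [])) := by
    rw [initF, fanoutFn_apply, fanoutFn_apply, fanoutFn_apply, fanoutFn_apply, Function.comp_apply, hctx, lenBinF_apply,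
      hcodes, hNbin, SubstUniform.stateStr, encList_nil]
  -- the run
  have hrounds : C.gates.length ≤ (boolPair (ones (Py.eval z.length)) (ones r)).length := by
    rw [length_boolPair, hyl, ← QCircuit.size]; omega
  have hrun := SubstUniform.loopModel_run (S := S) r (ones (Py.eval z.length)) [] hNW M (by rw [hyl]; exact hPy1)
    (by rw [hyl]; exact hPy2) C.gates (boolPair (ones (Py.eval z.length)) (ones r)).length N [] hrounds le_rfl le_rfl
    (fun g hg k e hge => by subst hge; exact hM k e hg)
  rw [List.nil_append] at hrun
  have hres : resF S q Py Dn z = boolPair (boolPair (ones (Py.eval z.length)) (ones r)) (boolPair []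
      (SubstUniform.stateStr ([] : List (QGate cliffordT N)) (N + (S.fix r).extra C.gates)
        ((OracleImpl.substGates (S.fix r) hNW N C.gates).map QGate.encode))) := by
    rw [resF, Function.comp_apply, hinit, SubstUniform.loopF, fstF_boolPair, eval_X,
      iterate_loopStep (SubstUniform.body S) _ _ _ _ le_rfl, hrun]
  have hacc : (sndPow 3 ∘ resF S q Py Dn) z = encList ((OracleImpl.substGates (S.fix r) hNW N C.gates).map QGate.encode) := by
    rw [Function.comp_apply, hres, SubstUniform.stateStr, sndPow_succ_boolPair, sndPow_succ_boolPair, sndPow_succ_boolPair,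
      sndPow_zero_boolPair]
  have hoff : (nthF 3 ∘ resF S q Py Dn) z = encodeNat (N + (S.fix r).extra C.gates) := by
    rw [Function.comp_apply, hres, SubstUniform.stateStr, nthF_succ_boolPair, nthF_succ_boolPair, nthF_succ_boolPair,
      nthF_zero_boolPair]
  have hextra : extraUF S q Py Dn z = ones ((S.fix r).extra C.gates) := by
    rw [extraUF, Function.comp_apply, fanoutFn_apply, polyFn_apply, Function.comp_apply, fanoutFn_apply, hoff, hNbin,
      subFn_boolPair, bitsToNat_encodeNat, bitsToNat_encodeNat, Nat.add_sub_cancel_left, binToUnaryFn_boolPair,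
      bitsToNat_encodeNat, hyl, Nat.min_eq_left (by omega)]
  -- assemble
  have e1 : CodeFP.unE (N + (S.fix r).extra C.gates) = CodeFP.unE N ++ ones ((S.fix r).extra C.gates) := by
    rw [CodeFP.unE_eq_ones, CodeFP.unE_eq_ones, ones, ones, ones, List.replicate_add]
  rw [descF, fanoutFn_apply, hacc, hextra, hDz, fstF_boolPair, UExec.tcE, CodeFP.pairE_apply, e1,
    ← QCircuit.encode_eq_rawE, OracleImpl.encode_substCirc]

end GenSubst

/-! ### Generated oracle circuits solve search problems -/

section Generated

open Complexity.CodeFP UExec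

/-- The first `N` entries of `List.ofFn f'` are `List.ofFn` of the restriction. [folklore] -/
theorem take_ofFn_eq_ofFn_castLE {N W : ℕ} (h : N ≤ W) (f : Fin W → Bool) :
    (List.ofFn f).take N = List.ofFn (f ∘ Fin.castLEEmb h) := by
  apply List.ext_getElem
  · simp [Nat.min_eq_left h]
  · intro i h1 h2
    rw [List.getElem_take, List.getElem_ofFn, List.getElem_ofFn]
    rfl

variable {Rel : List Bool → Set (List Bool)} {k : List Bool → ℕ}

/-- **Removing a `BQP` oracle from polynomial-time generated circuits** (`BQP^BQP = BQP`,
generated form). Let `A ∈ BQP`, let `C x` be a Clifford+`T` circuit on `k x ≥ 1` wires, possibly with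
oracle gates (querying `A`), whose description `(1^{k x}, rawGates (C x))` is computed from `x` in
polynomial time, `post ∈ FP`, and suppose that for every `x` the circuit `C x` run with the oracle `A`
on `|0…0⟩` and measured yields with probability `≥ 2/3 + δ` (`δ > 0`) a content `f` with
`post ⟨x, f⟩ ∈ Rel x`. Then the same holds at probability `≥ 2/3` for ORACLE-FREE circuits `C' x` on
`k' x ≥ 1` wires generated in polynomial time and a post-processor `post' ∈ FP`: replace every oracle
gate by the tidy block of precision `q(|x|)` of a uniform decider family for `A`
(`exists_uniform_deciderFamily`, `DeciderFamily.tidy_implements`; cost `≤ δ` in probability,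
`OracleImpl.probEvent_substCirc_ge`), whose description is again polynomial-time in `x`
(`GenSubst.descF_apply`); `post'` reads the first `k x` wires and applies `post`.
[cite: BennettBernsteinBrassardVazirani1997, Cor. 4.15 (BQP^BQP = BQP) with Thm. 4.13, Thm. 4.14]
[cite: NielsenChuang2010, §4.5 (uniform families written by a classical computer)] -/
theorem exists_generated_oracleFree {A : Language Bool} (hA : A ∈ BQP)
    (C : (x : List Bool) → QCircuit cliffordT (k x)) (hk : ∀ x, 1 ≤ k x)
    (hgen : CodeFP strE tcE fun x => (k x, (C x).rawGates))
    (post : List Bool → List Bool) (hpost : post ∈ FP) {δ : ℝ} (hδ : 0 < δ)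
    (hprob : ∀ x, 2 / 3 + δ ≤ (C x).probEvent A (basisState fun _ => false)
      {f | post (boolPair x (List.ofFn f)) ∈ Rel x}) :
    ∃ (k' : List Bool → ℕ) (C' : (x : List Bool) → QCircuit cliffordT (k' x)) (post' : List Bool → List Bool),
      (∀ x, (C' x).IsOracleFree) ∧ (∀ x, 1 ≤ k' x) ∧ CodeFP strE tcE (fun x => (k' x, (C' x).rawGates)) ∧
      post' ∈ FP ∧ ∀ x, 2 / 3 ≤ (C' x).probEvent 0 (basisState fun _ => false)
        {f | post' (boolPair x (List.ofFn f)) ∈ Rel x} := by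
  classical
  -- the tidy blocks of a uniform decider family for `A`
  obtain ⟨D, hDU, hDfree, hDdec⟩ := exists_uniform_deciderFamily hA
  set S : TidyFamily cliffordT := D.tidy with hS_def
  have hSU : S.IsUniform := DeciderFamily.tidy_isUniform hDU hDfree
  have himp : S.Implements A fun r => 2 / ((r : ℝ) + 1) := D.tidy_implements hDfree hDdec
  -- the description function and its length polynomial
  obtain ⟨Dn, hDn, hDn_eq⟩ := hgen
  have hDz : ∀ x, Dn x = boolPair (unE (k x)) (C x).encode := fun x => by
    rw [show Dn x = Dn (strE x) from rfl, hDn_eq x, QCircuit.encode_eq_rawE]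
    rfl
  obtain ⟨pd, hpd⟩ := exists_poly_length_le_of_mem_FP hDn
  have hsize : ∀ x, (C x).size ≤ pd.eval x.length ∧ k x ≤ pd.eval x.length := fun x => by
    have h := hpd x
    rw [hDz x, length_boolPair, length_unE] at h
    have h1 := QCircuit.size_le_length_encode (C x)
    exact ⟨by omega, by omega⟩
  -- the precision schedule
  obtain ⟨c₀, hc₀⟩ := exists_nat_ge (2 / δ)
  let q : Polynomial ℕ := Polynomial.C c₀ * pd + Polynomial.C c₀
  have hq : ∀ n, q.eval n = c₀ * pd.eval n + c₀ := fun n => by simp [q]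
  -- the substituted circuits
  let k' : List Bool → ℕ := fun x => k x + (S.fix (q.eval x.length)).extra (C x).gates
  let C' : (x : List Bool) → QCircuit cliffordT (k' x) := fun x => OracleImpl.substCirc (S.fix (q.eval x.length)) (C x)
  have hfree' : ∀ x, (C' x).IsOracleFree := fun x =>
    OracleImpl.substCirc_isOracleFree _ (himp (q.eval x.length)).isOracleFree _
  have hk' : ∀ x, 1 ≤ k' x := fun x => (hk x).trans (Nat.le_add_right _ _)
  -- sizes of the blocks met, and the yardstick
  obtain ⟨pS, hpS⟩ := exists_poly_length_le_of_mem_FP (TidyFamily.ddF_mem_FP_of_isUniform hSU)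
  let Mp : Polynomial ℕ := pS.comp (Polynomial.C 2 * pd + Polynomial.C 2 + q) + pd + Polynomial.C 1
  have hblock : ∀ (x : List Bool) (m : ℕ), m + 1 ≤ k x →
      (S.circ m (q.eval x.length)).size ≤ Mp.eval x.length ∧ m + 1 + S.anc m (q.eval x.length) ≤ Mp.eval x.length := by
    intro x m hm
    have h := hpS (unaryPairEncode (m, q.eval x.length))
    rw [TidyFamily.ddF_apply, length_boolPair, length_boolPair] at h
    have hl : (unaryPairEncode (m, q.eval x.length)).length = 2 * m + 2 + q.eval x.length := by
      simp [unaryPairEncode]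
    rw [hl] at h
    have hMp : Mp.eval x.length = pS.eval (2 * pd.eval x.length + 2 + q.eval x.length) + pd.eval x.length + 1 := by
      simp only [Mp, eval_add, eval_comp, eval_mul, eval_C]
    have hmono : pS.eval (2 * m + 2 + q.eval x.length) ≤ pS.eval (2 * pd.eval x.length + 2 + q.eval x.length) := by
      refine TM2Iter.eval_mono pS ?_
      have := (hsize x).2; omega
    have h1 := QCircuit.size_le_length_encode (S.circ m (q.eval x.length))
    have h2 : (unaryEncodeNat (S.anc m (q.eval x.length))).length = S.anc m (q.eval x.length) :=
      DeciderFamily.length_unaryEncodeNat _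
    have h4 := (hsize x).2
    rw [hMp]
    constructor <;> omega
  have hextra : ∀ x, (S.fix (q.eval x.length)).extra (C x).gates ≤ (C x).size * Mp.eval x.length := by
    intro x
    have key : ∀ gs : List (QGate cliffordT (k x)), (S.fix (q.eval x.length)).extra gs ≤ gs.length * Mp.eval x.length := by
      intro gs
      induction gs with
      | nil => exact Nat.zero_le _
      | cons g gs ih =>
        cases g with
        | gate s e =>
          have hex : (S.fix (q.eval x.length)).extra (QGate.gate s e :: gs) = (S.fix (q.eval x.length)).extra gs := rfl
          rw [hex, List.length_cons, Nat.succ_mul]; omega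
        | oracle m e =>
          have hm : m + 1 ≤ k x := by simpa using Fintype.card_le_of_embedding e
          have := (hblock x m hm).2
          have hex : (S.fix (q.eval x.length)).extra (QGate.oracle m e :: gs) =
              S.anc m (q.eval x.length) + (S.fix (q.eval x.length)).extra gs := rfl
          rw [hex, List.length_cons, Nat.succ_mul]; omega
    have h := key (C x).gates
    rwa [← QCircuit.size] at h
  let Py : Polynomial ℕ := pd + pd * Mp + Mp + pd + 1
  have hPy : ∀ x, k x + (S.fix (q.eval x.length)).extra (C x).gates ≤ Py.eval x.length ∧
      Mp.eval x.length ≤ Py.eval x.length ∧ (C x).size ≤ Py.eval x.length := by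
    intro x
    have h1 := hextra x
    have h2 := (hsize x).1
    have h3 := (hsize x).2
    have hP : Py.eval x.length = pd.eval x.length + pd.eval x.length * Mp.eval x.length + Mp.eval x.length + pd.eval x.length + 1 := by
      simp [Py]
    rw [hP]
    refine ⟨?_, by omega, by omega⟩
    nlinarith
  -- the description of the substituted circuits is polynomial time
  have hgen' : CodeFP strE tcE fun x => (k' x, (C' x).rawGates) := by
    refine CodeFP.of_fn (GenSubst.descF S q Py Dn) (GenSubst.descF_mem_FP hDn hSU) fun x => ?_
    exact GenSubst.descF_apply (C x) (hDz x) (Mp.eval x.length)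
      (fun m e he => hblock x m (by simpa using Fintype.card_le_of_embedding e)) (hPy x)
  -- the post-processor: truncate the register to the first `k x` wires, then `post`
  set K : List Bool → List Bool := fstF ∘ Dn with hK_def
  have hK : K ∈ FP := comp_mem_FP fstF_mem_FP hDn
  have hK_apply : ∀ x, K x = unE (k x) := fun x => by rw [hK_def, Function.comp_apply, hDz x, fstF_boolPair]
  set post' : List Bool → List Bool :=
    post ∘ fanoutFn fstF (Plumb.takeFn ∘ fanoutFn (K ∘ fstF) sndF) with hpost'_def
  have hpost' : post' ∈ FP := comp_mem_FP hpost (fanoutFn_mem_FP fstF_mem_FP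
    (comp_mem_FP Plumb.takeFn_mem_FP (fanoutFn_mem_FP (comp_mem_FP hK fstF_mem_FP) sndF_mem_FP)))
  have hpost'_apply : ∀ x y, post' (boolPair x y) = post (boolPair x (y.take (k x))) := by
    intro x y
    simp only [hpost'_def, Function.comp_apply, fanoutFn_apply, fstF_boolPair, sndF_boolPair, Plumb.takeFn_boolPair,
      hK_apply, length_unE]
  refine ⟨k', C', post', hfree', hk', hgen', hpost', fun x => ?_⟩
  -- the probability: at most `δ` is lost in the substitution
  have hε : (0 : ℝ) ≤ 2 / (((q.eval x.length : ℕ) : ℝ) + 1) := by positivity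
  have hmain := OracleImpl.probEvent_substCirc_ge (S.fix (q.eval x.length)) (himp (q.eval x.length)) hε (C x)
    (fun f => post (boolPair x (List.ofFn f)) ∈ Rel x)
  have hev : {f' : QReg (k' x) | post' (boolPair x (List.ofFn f')) ∈ Rel x} =
      {f' | post (boolPair x (List.ofFn (f' ∘ Fin.castLEEmb (Nat.le_add_right (k x) _)))) ∈ Rel x} := by
    ext f'
    rw [Set.mem_setOf_eq, Set.mem_setOf_eq, hpost'_apply, take_ofFn_eq_ofFn_castLE (Nat.le_add_right (k x) _)]
  rw [hev]
  refine le_trans ?_ hmain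
  -- the cost of the replaced gates
  set P : ℝ := ((pd.eval x.length : ℕ) : ℝ) with hPdef
  have hT : (OracleImpl.numOracle (C x).gates : ℝ) ≤ P := by
    rw [hPdef]
    exact_mod_cast (numOracle_le_size (C x)).trans (hsize x).1
  have hcost : (OracleImpl.numOracle (C x).gates : ℝ) * (2 / (((q.eval x.length : ℕ) : ℝ) + 1)) ≤ δ := by
    have hP : (0 : ℝ) ≤ P := Nat.cast_nonneg _
    have hc₀' : (2 : ℝ) ≤ δ * c₀ := by
      have := (div_le_iff₀ hδ).1 hc₀
      linarith
    have hQ : (((q.eval x.length : ℕ) : ℝ) + 1) = (c₀ : ℝ) * (P + 1) + 1 := by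
      rw [hq, hPdef]; push_cast; ring
    have hden : (0 : ℝ) < (c₀ : ℝ) * (P + 1) + 1 := by positivity
    rw [hQ]
    calc (OracleImpl.numOracle (C x).gates : ℝ) * (2 / ((c₀ : ℝ) * (P + 1) + 1))
        ≤ P * (2 / ((c₀ : ℝ) * (P + 1) + 1)) := mul_le_mul_of_nonneg_right hT (by positivity)
      _ = 2 * P / ((c₀ : ℝ) * (P + 1) + 1) := by ring
      _ ≤ δ := by
        rw [div_le_iff₀ hden]
        nlinarith [hc₀', hP, hδ]
  have := hprob x
  linarith

end Generated

end Literature.Computability.QuantumComplexity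

end
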